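import Summits.QuantumAdvantage.AdviceFreeQNC0.NPGamma37Sym
import HarnessLib

/-!
# Cell qa-qnc0 — (NP-Σ) part 2: balanced base points have density `2^{-F}`; `|x|` is frozen on balanced slices; the class `PS`.

Planner qa-qnc0-p2 gen 34 (INBOX P2-34h, memo HOME/qa-qnc0-p2/ROUND-34P2.md §4.9).  Part of the (NP-Σ) proof
`NPGamma37Sym` (statements, antipodal resonance, the BALANCED resonance MGF `resonance_windows_bal`/`resonance_poly_bal`) →
`NPGamma37SymFreeze` (density of balanced base points `card_balAll`, the window transposition and FREEZING `wtX_U`, the class `PS`) →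
`NPGamma37SymLoss` (the assembly `symLoss` and the theorems `ringHardSymFourier3`, `ringHardSymLinForms3`).
-/

noncomputable section

namespace Summit.QuantumAdvantage.AdviceFreeQNC0.NPGamma37Proof

open Finset F4
open Classical
open Summit.QuantumAdvantage.AdviceFreeQNC0.AffBells37 (exists_ne_one_of_mass_lt ev L sparse_ne_one two_pow_L_le)
open Summit.QuantumAdvantage.AdviceFreeQNC0.Resonance37G (orbit_mgf blockCpl blockCpl_involutive uExt_blockCpl xN xN_eq_xOfU
  xN_blockCpl_of_ne xN_blockCpl_left xN_blockCpl_right Inv letter)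

variable {F : ℕ}

section Sym

open Literature.Computability.QuantumComplexity Literature.Computability.QuantumComplexity.RingHLF
open Literature.Computability.MetaComplexity
open AffBells23 AffBells26
open Summit.QuantumAdvantage.AdviceFreeQNC0.NPGamma37 (InsulatedWindows)

variable {n : ℕ}
variable {N : ℕ}
variable {R : ℕ}

/-! ### 2. Balanced base points have density `2^{-F}` -/

/-- windows `j < k` balanced. -/
def BalLt (p : ℕ → ℕ) (F k : ℕ) (a : Fin n → Bool) : Prop :=
  ∀ j : Fin F, j.val < k → xN a (p j) ≠ xN a (p j + 1)

/-- Each further balance constraint halves the count (the involution `u_{p_k+1} ↦ ¬u_{p_k+1}` toggles window `k` only). -/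
theorem card_balLt {p : ℕ → ℕ} (hS : Sep n F p) : ∀ k ≤ F,
    (univ.filter fun a : Fin n → Bool => BalLt p F k a).card * 2 ^ k = 2 ^ n := by
  intro k hk
  induction k with
  | zero =>
    have h0 : (univ.filter fun a : Fin n → Bool => BalLt p F 0 a) = univ :=
      filter_true_of_mem fun a _ j hj => absurd hj (Nat.not_lt_zero _)
    rw [h0, card_univ, Fintype.card_fun, Fintype.card_bool, Fintype.card_fin, pow_zero, mul_one]
  | succ k ih =>
    have hkF : k < F := hk
    have ih' := ih (by omega)
    set S := univ.filter fun a : Fin n → Bool => BalLt p F k a with hSdef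
    have hmemS : ∀ a, a ∈ S ↔ BalLt p F k a := fun a => by rw [hSdef, mem_filter]; simp
    set jk : Fin F := ⟨k, hkF⟩ with hjk
    have hsplit := Finset.card_filter_add_card_filter_not (s := S) (fun a => xN a (p jk) ≠ xN a (p jk + 1))
    have hnext : (univ.filter fun a : Fin n → Bool => BalLt p F (k + 1) a)
        = S.filter fun a => xN a (p jk) ≠ xN a (p jk + 1) := by
      rw [hSdef, filter_filter]
      refine filter_congr fun a _ => ?_
      constructor
      · intro h
        exact ⟨fun j hj => h j (by omega), h jk (by simp [hjk])⟩
      · rintro ⟨h1, h2⟩ j hj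
        by_cases hjk' : j.val = k
        · have : j = jk := Fin.ext hjk'
          rw [this]; exact h2
        · exact h1 j (by omega)
    -- the involution
    have htn : p jk + 1 < n := (hS.1 jk).2
    have eS : ∀ (a : Fin n → Bool) (j : Fin F), j.val < k →
        xN (blockCpl (p jk + 1) (p jk + 1) a) (p j) = xN a (p j) ∧
          xN (blockCpl (p jk + 1) (p jk + 1) a) (p j + 1) = xN a (p j + 1) := by
      intro a j hj
      have hs := hS.2 j jk (by simpa [hjk] using hj)
      exact ⟨xN_blockCpl_of_ne _ _ le_rfl htn a _ (by omega) (by omega),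
        xN_blockCpl_of_ne _ _ le_rfl htn a _ (by omega) (by omega)⟩
    have hθS : ∀ a : Fin n → Bool, BalLt p F k (blockCpl (p jk + 1) (p jk + 1) a) ↔ BalLt p F k a := by
      intro a
      constructor
      · intro h j hj
        have := h j hj
        rwa [(eS a j hj).1, (eS a j hj).2] at this
      · intro h j hj
        rw [(eS a j hj).1, (eS a j hj).2]
        exact h j hj
    have hθk : ∀ a : Fin n → Bool,
        (xN (blockCpl (p jk + 1) (p jk + 1) a) (p jk) ≠ xN (blockCpl (p jk + 1) (p jk + 1) a) (p jk + 1))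
        ↔ ¬ (xN a (p jk) ≠ xN a (p jk + 1)) := by
      intro a
      rw [xN_blockCpl_of_ne _ _ le_rfl htn a _ (by omega) (by omega), xN_blockCpl_left _ _ le_rfl htn a]
      cases xN a (p jk) <;> cases xN a (p jk + 1) <;> simp
    have hhalf : (S.filter fun a => xN a (p jk) ≠ xN a (p jk + 1)).card
        = (S.filter fun a => ¬ (xN a (p jk) ≠ xN a (p jk + 1))).card := by
      refine Finset.card_bij (fun a _ => blockCpl (p jk + 1) (p jk + 1) a) ?_ ?_ ?_
      · intro a ha
        rw [mem_filter, hmemS] at ha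
        rw [mem_filter, hmemS]
        exact ⟨(hθS a).2 ha.1, fun h => (hθk a).1 h ha.2⟩
      · intro a₁ _ a₂ _ h
        exact (blockCpl_involutive _ _).injective h
      · intro b hb
        rw [mem_filter, hmemS] at hb
        refine ⟨blockCpl (p jk + 1) (p jk + 1) b, ?_, blockCpl_involutive _ _ b⟩
        rw [mem_filter, hmemS]
        exact ⟨(hθS b).2 hb.1, (hθk b).2 hb.2⟩
    rw [hnext]
    calc (S.filter fun a => xN a (p jk) ≠ xN a (p jk + 1)).card * 2 ^ (k + 1)
        = ((S.filter fun a => xN a (p jk) ≠ xN a (p jk + 1)).card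
            + (S.filter fun a => xN a (p jk) ≠ xN a (p jk + 1)).card) * 2 ^ k := by rw [pow_succ]; ring
      _ = S.card * 2 ^ k := by rw [← hsplit, hhalf]
      _ = 2 ^ n := ih'

/-- `#balanced · 2^F = 2ⁿ`. -/
theorem card_balAll {p : ℕ → ℕ} (hS : Sep n F p) :
    (univ.filter fun a : Fin n → Bool => BalAll p F a).card * 2 ^ F = 2 ^ n := by
  have h : (univ.filter fun a : Fin n → Bool => BalAll p F a) = univ.filter fun a : Fin n → Bool => BalLt p F F a :=
    filter_congr fun a _ => ⟨fun h j _ => h j, fun h j => h j j.2⟩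
  rw [h]
  exact card_balLt hS F le_rfl

/-! ### 3. Window transpositions: `|x|` is constant on balanced slices -/

/-- the position swap `p j ↔ p j + 1` at the moved windows (`v_j = 1`), identity elsewhere. -/
def swp (p : ℕ → ℕ) (v : Fin F → Bool) (i : ℕ) : ℕ :=
  if (∃ j : Fin F, i = p j ∧ v j = true) then i + 1
  else if (∃ j : Fin F, i = p j + 1 ∧ v j = true) then i - 1 else i

/-- The window transposition sends an active left letter `p_j` to `p_j + 1`. -/
theorem swp_left {p : ℕ → ℕ} (v : Fin F → Bool) {i : ℕ} (h : ∃ j : Fin F, i = p j ∧ v j = true) :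
    swp p v i = i + 1 := by
  unfold swp; rw [if_pos h]

/-- The window transposition sends an active right letter `p_j + 1` to `p_j`. -/
theorem swp_right {p : ℕ → ℕ} (hS : Sep n F p) (v : Fin F → Bool) {i : ℕ}
    (h : ∃ j : Fin F, i = p j + 1 ∧ v j = true) : swp p v i = i - 1 := by
  have h1 : ¬ ∃ j : Fin F, i = p j ∧ v j = true := by
    rintro ⟨j', hj', -⟩
    obtain ⟨j, hj, -⟩ := h
    by_cases hjj : j = j'
    · subst hjj; omega
    · rcases hS.ne hjj with h3 | h3 <;> omega
  unfold swp; rw [if_neg h1, if_pos h]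

/-- The window transposition fixes every other position. -/
theorem swp_none {p : ℕ → ℕ} (v : Fin F → Bool) {i : ℕ} (h1 : ¬ ∃ j : Fin F, i = p j ∧ v j = true)
    (h2 : ¬ ∃ j : Fin F, i = p j + 1 ∧ v j = true) : swp p v i = i := by
  unfold swp; rw [if_neg h1, if_neg h2]

/-- `swp p v` is an involution. -/
theorem swp_swp {p : ℕ → ℕ} (hS : Sep n F p) (v : Fin F → Bool) (i : ℕ) : swp p v (swp p v i) = i := by
  by_cases h1 : ∃ j : Fin F, i = p j ∧ v j = true
  · rw [swp_left v h1]
    obtain ⟨j, hj, hvj⟩ := h1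
    rw [swp_right hS v ⟨j, by omega, hvj⟩]
    omega
  · by_cases h2 : ∃ j : Fin F, i = p j + 1 ∧ v j = true
    · rw [swp_right hS v h2]
      obtain ⟨j, hj, hvj⟩ := h2
      rw [swp_left v ⟨j, by omega, hvj⟩]
      omega
    · rw [swp_none v h1 h2, swp_none v h1 h2]

/-- `swp p v` preserves `< n + 1`. -/
theorem swp_lt {p : ℕ → ℕ} (hS : Sep n F p) (v : Fin F → Bool) {i : ℕ} (hi : i < n + 1) : swp p v i < n + 1 := by
  by_cases h1 : ∃ j : Fin F, i = p j ∧ v j = true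
  · rw [swp_left v h1]
    obtain ⟨j, hj, -⟩ := h1
    have := (hS.1 j).2
    omega
  · by_cases h2 : ∃ j : Fin F, i = p j + 1 ∧ v j = true
    · rw [swp_right hS v h2]; omega
    · rw [swp_none v h1 h2]; exact hi

/-- the window transposition as a permutation of the data positions `Fin (n+1)`. -/
def swpPerm {p : ℕ → ℕ} (hS : Sep n F p) (v : Fin F → Bool) : Equiv.Perm (Fin (n + 1)) :=
  Function.Involutive.toPerm (fun i => ⟨swp p v i.val, swp_lt hS v i.2⟩) (fun i => Fin.ext (swp_swp hS v i.val))

/-- On a balanced slice the pair move permutes the data bits: `x_i(U a v) = x_{swp i}(a)`. -/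
theorem xOfU_U_swp {p : ℕ → ℕ} (hS : Sep n F p) (a : Fin n → Bool) (v : Fin F → Bool) (hbal : BalAll p F a)
    (i : Fin (n + 1)) : xOfU (U p a v) i = xOfU a (swpPerm hS v i) := by
  have hval : (swpPerm hS v i).val = swp p v i.val := rfl
  rw [xOfU_U_eq hS, ← xN_eq_xOfU a (swpPerm hS v i), hval, ← xN_eq_xOfU a i]
  by_cases h1 : ∃ j : Fin F, i.val = p j ∧ v j = true
  · obtain ⟨j, hj, hvj⟩ := h1
    rw [if_pos ⟨j, Or.inl hj, hvj⟩, swp_left v ⟨j, hj, hvj⟩, hj]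
    have hb := hbal j
    revert hb
    cases xN a (p j) <;> cases xN a (p j + 1) <;> simp
  · by_cases h2 : ∃ j : Fin F, i.val = p j + 1 ∧ v j = true
    · obtain ⟨j, hj, hvj⟩ := h2
      rw [if_pos ⟨j, Or.inr hj, hvj⟩, swp_right hS v ⟨j, hj, hvj⟩, hj, Nat.add_sub_cancel]
      have hb := hbal j
      revert hb
      cases xN a (p j) <;> cases xN a (p j + 1) <;> simp
    · have h3 : ¬ ∃ j : Fin F, (i.val = p j ∨ i.val = p j + 1) ∧ v j = true := by
        rintro ⟨j, hj | hj, hvj⟩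
        · exact h1 ⟨j, hj, hvj⟩
        · exact h2 ⟨j, hj, hvj⟩
      rw [if_neg h3, swp_none v h1 h2]

/-- **FREEZING**: `|x|` is constant on the slice of a balanced base point. -/
theorem wtX_U {p : ℕ → ℕ} (hS : Sep n F p) (a : Fin n → Bool) (v : Fin F → Bool) (hbal : BalAll p F a) :
    wtX (xOfU (U p a v)) = wtX (xOfU a) := by
  unfold wtX
  rw [card_filter, card_filter]
  simp_rw [xOfU_U_swp hS a v hbal]
  exact Equiv.sum_comp (swpPerm hS v) (fun i => if xOfU a i = true then 1 else 0)

/-! ### 4. The class and its slices -/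

/-- the (NP-Σ) strategy `y_g(x) = f_g(|x|, Q_{g,·}(x))` as a `ZMod 3`-valued family. -/
def PS (Q : Fin (n + 1) → Fin R → Smolensky.CubeFn (ZMod 3) (n + 1)) (f : Fin (n + 1) → ℕ → (Fin R → ZMod 3) → Bool) :
    Fin (n + 1) → Smolensky.CubeFn (ZMod 3) (n + 1) :=
  fun g x => if f g (wtX x) (qvals Q g x) then 1 else 0

/-- The output word of the symmetric strategy `PS Q f` is `g ↦ f g |x| (qvals Q g x)`. -/
theorem zOf_PS (Q : Fin (n + 1) → Fin R → Smolensky.CubeFn (ZMod 3) (n + 1))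
    (f : Fin (n + 1) → ℕ → (Fin R → ZMod 3) → Bool) (x : Fin (n + 1) → Bool) :
    zOf (PS Q f) x = fun g => f g (wtX x) (qvals Q g x) := by
  funext g
  unfold zOf PS
  cases f g (wtX x) (qvals Q g x) <;> simp

/-- the frozen tables on the slice of `a`: `f_g(|x(a)|, ·)`. -/
def fz (f : Fin (n + 1) → ℕ → (Fin R → ZMod 3) → Bool) (a : Fin n → Bool) :
    Fin (n + 1) → (Fin R → ZMod 3) → Bool :=
  fun g t => f g (wtX (xOfU a)) t

/-- on a balanced slice the (NP-Σ) strategy IS the Fourier-class strategy of the frozen tables. -/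
theorem PQ_fz_eq_PS {p : ℕ → ℕ} (hS : Sep n F p) (Q : Fin (n + 1) → Fin R → Smolensky.CubeFn (ZMod 3) (n + 1))
    (f : Fin (n + 1) → ℕ → (Fin R → ZMod 3) → Bool) (a : Fin n → Bool) (hbal : BalAll p F a)
    (v : Fin F → Bool) (g : Fin (n + 1)) :
    PQ Q (fz f a) g (xOfU (U p a v)) = PS Q f g (xOfU (U p a v)) := by
  show (if f g (wtX (xOfU a)) (qvals Q g (xOfU (U p a v))) then (1 : ZMod 3) else 0)
      = (if f g (wtX (xOfU (U p a v))) (qvals Q g (xOfU (U p a v))) then (1 : ZMod 3) else 0)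
  rw [wtX_U hS a v hbal]

/-- the walk win bit depends on the strategy only through its values at the point. -/
theorem Wn_congr {P P' : Fin (n + 1) → Smolensky.CubeFn (ZMod 3) (n + 1)} {u : Fin n → Bool}
    (h : ∀ g, P g (xOfU u) = P' g (xOfU u)) : Wn P u = Wn P' u := by
  have hy : ∀ g, yOf P g u = yOf P' g u := fun g => by unfold yOf zOf; rw [h g]
  unfold Wn ringWinU
  have hf : (univ.filter fun g : Fin (n + 1) => yOf P g u = true ∧ (n + 2 + g.val + walkExp u g.val) % 3 ≠ 0)
      = (univ.filter fun g : Fin (n + 1) => yOf P' g u = true ∧ (n + 2 + g.val + walkExp u g.val) % 3 ≠ 0) :=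
    filter_congr fun g _ => by rw [hy g]
  rw [hf]

/-- from a core loss bound with denominator `D ≤ (n+1)^e` to the `1 − N^{−e}` law. -/
theorem law_of_lossD {c e : ℕ} {D : ℝ} (hD : 0 < D) (hmain : ((c : ℕ) : ℝ) ≤ (2 : ℝ) ^ n - (2 : ℝ) ^ n / D)
    (hK : D ≤ ((n : ℝ) + 1) ^ e) : ((c : ℕ) : ℝ) ≤ (1 - 1 / ((n : ℝ) + 1) ^ e) * (2 : ℝ) ^ n := by
  have h2n : (0 : ℝ) < (2 : ℝ) ^ n := by positivity
  have hdiv : (2 : ℝ) ^ n / ((n : ℝ) + 1) ^ e ≤ (2 : ℝ) ^ n / D := div_le_div_of_nonneg_left h2n.le hD hK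
  calc ((c : ℕ) : ℝ) ≤ (2 : ℝ) ^ n - (2 : ℝ) ^ n / D := hmain
    _ ≤ (2 : ℝ) ^ n - (2 : ℝ) ^ n / ((n : ℝ) + 1) ^ e := by linarith
    _ = (1 - 1 / ((n : ℝ) + 1) ^ e) * (2 : ℝ) ^ n := by ring

end Sym

end Summit.QuantumAdvantage.AdviceFreeQNC0.NPGamma37Proof
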